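import Summits.ValiantsHypothesis.ValiantsHypothesis.Theses.ProjectionStability
import Summits.ValiantsHypothesis.ValiantsHypothesis.Theses.ProjectionRigidity
import Literature.Computability.AlgebraicComplexity.DeterminantalComplexityProofs
import Summits.ValiantsHypothesis.ValiantsHypothesis.Theorems.PdcQpOfVp.Negative.AffineToProjectionBlowup

/-!
# Negative-side facts for the crux `ProjectionStability.OptStep` (stmt-ValiantsHypothesis-17835)

`OptStep = ∀ n ≥ 3, Opt n → Uniq n → Opt (n+1)` (`Opt n := 2ⁿ − 1 ≤ pdc(per_n)`, `Uniq n :=` optimal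
projections of `per_n` unique modulo gauge × `permSymmetrySubst` × transpose).  Refuter (cdisprove)
lemmas locating every possible refutation of the crux; none asserts a route item:

* `not_optStep_of_uniqBase_of_isDetProjection` — THE KILL CRITERION IS A THEOREM: the finite base
  `UniqBase` (stmt-17836) together with a projection of `per_4` of any size `m ≤ 14` refutes `OptStep`
  (because `Opt 3` is a theorem of the tree: `opt_three`, Alper–Bogart–Velasco).
* `pdc_perPoly_four_le_of_not_optStep_three` — conversely a failure of the crux AT LEVEL 3 forces
  `pdc(per_4) ≤ 14` (no such matrix is known; Hüttenhain–Ikenmeyer 2016 could not settle even the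
  0/1-constant case `bdc(per_4)`).
* `not_optStep_iff_tail` — modulo the parent's certified-computation item `PdcPerFour`
  (`pdc(per_4) = 15`), `¬ OptStep` is EQUIVALENT to a failure at some level `n ≥ 4` WITH `Opt n` — i.e.
  a refutation must first PROVE Grenet-optimality at some `n ≥ 4` (an instance of the open target) and
  then beat Grenet at `n + 1`.  This is why the crux resists disproof.
* `not_optStep_strict` — the natural strengthening of the (n-unrestricted) body, "drop the `−1`":
  `Opt n → Uniq n → 2^(n+1) ≤ pdc(per_{n+1})`, is FALSE (at `n = 0`: `pdc(per_1) = 1`, with `Opt 0`,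
  `Uniq 0` honestly discharged — `pdc(per_0) = 0`, `0 × 0` matrices; the small values of `pdc` are the
  landed `PdcQpOfVp.Negative` lemmas), so the constant in the conclusion is sharp and the degenerate
  levels carry no junk.
Workfile with the full analysis: `Cruxes/OptStep/Disproof.lean`. [folklore]
-/

namespace Summit.ValiantsHypothesis.Theorems.OptStep.Negative

open MvPolynomial Literature.Computability.AlgebraicComplexity
open Summit.ValiantsHypothesis.ValiantsHypothesis.Theses.ProjectionStability (OptStep UniqBase)
open Summit.ValiantsHypothesis.ValiantsHypothesis.Theses.ProjectionRigidity (PdcPerFour)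
open Summit.ValiantsHypothesis.Theorems.PdcQpOfVp.Negative (detProjectionComplexity_perPoly_zero detProjectionComplexity_perPoly_one)

/-- `Opt 3`: `7 ≤ dc(per_3) ≤ pdc(per_3)` (Alper–Bogart–Velasco 2017, in tree; this is step (1) of
the route's `closes`). [cite: AlperBogartVelasco2017, Cor. 1.4] -/
theorem opt_three : 2 ^ 3 - 1 ≤ Literature.Computability.AlgebraicComplexity.detProjectionComplexity (Literature.Computability.AlgebraicComplexity.perPoly (Fin 3) ℂ) := by
  have h2 : (2 : ℂ) ≠ 0 := two_ne_zero
  obtain ⟨A, hA⟩ := hasDetRepr_determinantalComplexity_holds (perPoly (Fin 3) ℂ)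
  obtain ⟨W, hW, hvan⟩ := AlperBogartVelasco.exists_subspace_of_isAffineDetRepr_perPoly h2 le_rfl hA
  have hfin : Module.finrank ℂ W ≤ 3 := by
    refine AlperBogartVelasco.finrank_le_three_of_subperm_two_vanish W fun x hx r c => ?_
    have key : MvPolynomial.eval x (MvPolynomial.pderiv (r, c) (perPoly (Fin 3) ℂ)) =
        ((Matrix.of fun i j => x (i, j)).submatrix r.succAbove c.succAbove).permanent := by
      rw [VonZurGathen.pderiv_perPoly, ← MvPolynomial.aeval_eq_eval, VonZurGathen.aeval_subperm_X,
        Matrix.subperm_eq_permanent_of_equiv _ (finSuccAboveEquiv c) (finSuccAboveEquiv r)]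
      rfl
    rw [← key]
    exact hvan x hx (r, c)
  have h7 : 2 ^ 3 - 1 ≤ determinantalComplexity (perPoly (Fin 3) ℂ) := by
    norm_num at hW ⊢
    omega
  exact h7.trans (determinantalComplexity_le_detProjectionComplexity_holds _)

/-- **The kill criterion is a theorem.**  `UniqBase` and a projection of `per_4` of any size
`m ≤ 14` refute `OptStep` (instantiate the crux at `n = 3` with `opt_three`). [folklore] -/
theorem not_optStep_of_uniqBase_of_isDetProjection (hB : UniqBase) {m : ℕ} (hm : m ≤ 14)
    (h : IsDetProjection (perPoly (Fin 4) ℂ) m) : ¬ OptStep := fun hO => by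
  have h15 : 2 ^ 4 - 1 ≤ Literature.Computability.AlgebraicComplexity.detProjectionComplexity (Literature.Computability.AlgebraicComplexity.perPoly (Fin 4) ℂ) := hO 3 le_rfl opt_three hB
  have hle : Literature.Computability.AlgebraicComplexity.detProjectionComplexity (Literature.Computability.AlgebraicComplexity.perPoly (Fin 4) ℂ) ≤ m := Nat.sInf_le h
  omega

/-- Conversely: if the crux fails AT LEVEL 3 then `pdc(per_4) ≤ 14` (and `UniqBase` holds).
[folklore] -/
theorem pdc_perPoly_four_le_of_not_optStep_three
    (h : ¬ (2 ^ 3 - 1 ≤ Literature.Computability.AlgebraicComplexity.detProjectionComplexity (Literature.Computability.AlgebraicComplexity.perPoly (Fin 3) ℂ) → UniqBase → 2 ^ 4 - 1 ≤ Literature.Computability.AlgebraicComplexity.detProjectionComplexity (Literature.Computability.AlgebraicComplexity.perPoly (Fin 4) ℂ))) :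
    Literature.Computability.AlgebraicComplexity.detProjectionComplexity (Literature.Computability.AlgebraicComplexity.perPoly (Fin 4) ℂ) ≤ 14 ∧ UniqBase := by
  push Not at h
  obtain ⟨-, hU, hlt⟩ := h
  exact ⟨by omega, hU⟩

/-- **Where a refutation can live.**  Modulo `PdcPerFour` (`pdc(per_4) = 15`, the parent route's
certified-computation item stmt-16002), `¬ OptStep` is equivalent to a failure at a level `n ≥ 4`
together with `Opt n` there — an instance of the open target. [folklore] -/
theorem not_optStep_iff_tail (h4 : PdcPerFour) :
    ¬ OptStep ↔ ∃ n ≥ 4, 2 ^ n - 1 ≤ Literature.Computability.AlgebraicComplexity.detProjectionComplexity (Literature.Computability.AlgebraicComplexity.perPoly (Fin n) ℂ) ∧ (∀ A B : Matrix (Fin (Literature.Computability.AlgebraicComplexity.detProjectionComplexity (Literature.Computability.AlgebraicComplexity.perPoly (Fin n) ℂ))) (Fin (Literature.Computability.AlgebraicComplexity.detProjectionComplexity (Literature.Computability.AlgebraicComplexity.perPoly (Fin n) ℂ))) (MvPolynomial (Fin n × Fin n) ℂ), (∀ i j, (∃ v, A i j = MvPolynomial.X v) ∨ ∃ c, A i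 j = MvPolynomial.C c) → (∀ i j, (∃ v, B i j = MvPolynomial.X v) ∨ ∃ c, B i j = MvPolynomial.C c) → A.det = Literature.Computability.AlgebraicComplexity.perPoly (Fin n) ℂ → B.det = Literature.Computability.AlgebraicComplexity.perPoly (Fin n) ℂ → ∃ (P Q : GL (Fin (Literature.Computability.AlgebraicComplexity.detProjectionComplexity (Literature.Computability.AlgebraicComplexity.perPoly (Fin n) ℂ))) ℂ) (γ : GL (Fin n × Fin n) ℂ), γ ∈ Literature.Computability.AlgebraicComplexity.permSymmetrySubst ℂ n ∧ (B = (P : Matrix _ _ ℂ).map MvPolynomial.C * Literature.Computability.AlgebraicComplexity.Matrix.linSubstEntries γ A * (Q : Matrix _ _ ℂ).map MvPolynomial.C ∨ B = (P : Matrix _ _ ℂ).map MvPolynomial.C * (Literature.Computability.AlgebraicComplexity.Matrix.linSubstEntries γ A).transpose * (Q : Matrix _ _ ℂ).map MvPolynomial.C)) ∧ Literature.Computability.AlgebraicComplexity.detProjectionComplexity (Literature.Computability.AlgebraicComplexity.perPoly (Fin (n + 1)) ℂ) ≤ 2 ^ (n + 1) - 2 := by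
  unfold PdcPerFour at h4
  constructor
  · intro hO
    unfold Summit.ValiantsHypothesis.ValiantsHypothesis.Theses.ProjectionStability.OptStep at hO
    push Not at hO
    obtain ⟨n, hn, ho, hu, hlt⟩ := hO
    rcases Nat.lt_or_ge n 4 with hlt4 | hge
    · obtain rfl : n = 3 := by omega
      exfalso
      change Literature.Computability.AlgebraicComplexity.detProjectionComplexity (Literature.Computability.AlgebraicComplexity.perPoly (Fin 4) ℂ) < 2 ^ 4 - 1 at hlt
      omega
    · exact ⟨n, hge, ho, hu, by have : 1 ≤ 2 ^ (n + 1) := Nat.one_le_two_pow; omega⟩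
  · rintro ⟨n, hn, ho, hu, hle⟩ hO
    have := hO n (by omega) ho hu
    have : 1 ≤ 2 ^ (n + 1) := Nat.one_le_two_pow
    omega

/-! ### The degenerate levels carry no junk, and the `−1` is sharp -/

/-- **The strict strengthening of the crux body is false** ("drop the `−1`", no restriction on `n`):
at `n = 0` the hypotheses hold honestly (`Opt 0 = (0 ≤ _)`; `Uniq 0`: optimal projections of
`per_0 = 1` are `0 × 0` matrices) and the conclusion `2 ≤ pdc(per_1) = 1` fails.  So the constant of
the conclusion is sharp, and nothing is hidden in the side condition `n ≥ 3` at the bottom end.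
[folklore] -/
theorem not_optStep_strict : ¬ (∀ n : ℕ, 2 ^ n - 1 ≤ Literature.Computability.AlgebraicComplexity.detProjectionComplexity (Literature.Computability.AlgebraicComplexity.perPoly (Fin n) ℂ) → (∀ A B : Matrix (Fin (Literature.Computability.AlgebraicComplexity.detProjectionComplexity (Literature.Computability.AlgebraicComplexity.perPoly (Fin n) ℂ))) (Fin (Literature.Computability.AlgebraicComplexity.detProjectionComplexity (Literature.Computability.AlgebraicComplexity.perPoly (Fin n) ℂ))) (MvPolynomial (Fin n × Fin n) ℂ), (∀ i j, (∃ v, A i j = MvPolynomial.X v) ∨ ∃ c, A i j = MvPolynomial.C c) → (∀ i j, (∃ v, B i j = MvPolynomial.X v) ∨ ∃ c, B i j = MvPolynomial.C c) → A.det = Literature.Computability.AlgebraicComplexity.perPoly (Fin n) ℂ → B.det = Literature.Computability.AlgebraicComplexity.perPoly (Fin n) ℂ → ∃ (P Q : GL (Fin (Literature.Computability.AlgebraicComplexity.detProjectionComplexity (Literature.Computability.AlgebraicComplexity.perPoly (Fin n) ℂ))) ℂ) (γ : GL (Fin n × Fin n) ℂ), γ ∈ Literature.Computability.AlgebraicComplexity.permSymmetrySubst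 ℂ n ∧ (B = (P : Matrix _ _ ℂ).map MvPolynomial.C * Literature.Computability.AlgebraicComplexity.Matrix.linSubstEntries γ A * (Q : Matrix _ _ ℂ).map MvPolynomial.C ∨ B = (P : Matrix _ _ ℂ).map MvPolynomial.C * (Literature.Computability.AlgebraicComplexity.Matrix.linSubstEntries γ A).transpose * (Q : Matrix _ _ ℂ).map MvPolynomial.C)) → 2 ^ (n + 1) ≤ Literature.Computability.AlgebraicComplexity.detProjectionComplexity (Literature.Computability.AlgebraicComplexity.perPoly (Fin (n + 1)) ℂ)) := by
  intro h
  have hU := h 0 (Nat.zero_le _)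
  have h0 := detProjectionComplexity_perPoly_zero
  haveI : IsEmpty (Fin (Literature.Computability.AlgebraicComplexity.detProjectionComplexity (Literature.Computability.AlgebraicComplexity.perPoly (Fin 0) ℂ))) := by rw [h0]; infer_instance
  have h2 : 2 ^ (0 + 1) ≤ Literature.Computability.AlgebraicComplexity.detProjectionComplexity (Literature.Computability.AlgebraicComplexity.perPoly (Fin (0 + 1)) ℂ) := by
    refine hU ?_
    intro A B _ _ _ _
    refine ⟨1, 1, 1, Subgroup.one_mem _, Or.inl ?_⟩
    ext i j
    exact isEmptyElim i
  have h1 : Literature.Computability.AlgebraicComplexity.detProjectionComplexity (Literature.Computability.AlgebraicComplexity.perPoly (Fin (0 + 1)) ℂ) = 1 :=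
    detProjectionComplexity_perPoly_one
  omega

end Summit.ValiantsHypothesis.Theorems.OptStep.Negative
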